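import Summits.CriticalPhenomena.SAWScalingLimit.Theorems.SAWDefectDecoherenceBoundaryClosureRSqueezeMembership
import Summits.CriticalPhenomena.SAWScalingLimit.Theorems.SAWDefectDecoherenceBoundaryClosureRSqueezeBudget
import Summits.CriticalPhenomena.SAWScalingLimit.Theorems.SAWDefectDecoherenceBoundaryClosureRSqueezeProfilePinch
import Summits.CriticalPhenomena.SAWScalingLimit.Theorems.SAWDefectDecoherenceBoundaryClosureRSqueezeGateStability
import HarnessLib

/-!
# Crux `BoundaryClosureR` (stmt-CriticalPhenomena-14004), line `polygon-parity-squeeze`,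
# stub `stub_squeeze`: THE SQUEEZE (mechanism (B)) reduced to two classical facts

Landing target:
`Summits/CriticalPhenomena/SAWScalingLimit/Theorems/SAWDefectDecoherenceBoundaryClosureRSqueeze.lean`
(`--supports stmt-CriticalPhenomena-14004`).

The registered stub `stub_squeeze : ArrivalMonotone → PolygonGateProfile → PolygonPackage →
GateCollarAvoidance → GateData` of `Cruxes/BoundaryClosureR/Lines/polygon_parity_squeeze.lean` is
proved here CONDITIONALLY on two explicitly displayed inputs, neither of which is in the tree:

* **(IP) inner exact polygons** — for every admissible pinned datum `(D, ρ, Λ, m, b; a, r₀, m₀)` with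
  disjoint pinned balls and every collar width `η > 0` there is a Dobrushin domain `P ⊆ Ω` with the
  same marked points, containing the `η`-interior `{z ∈ Ω | η ≤ dist(z, ℂ ∖ Ω)}`, and an exact polygon
  family `Λ^P` on it (`AdmissibleFamily P (ρ/2) Λ^P m b`, `ExactPolygonFamily P Λ^P`,
  `PinnedFlatRoot P Λ^P b (pt 0) a (min r₀ ρ / 4) m₀`) sandwiched as
  `collarDomain D (3ρ/4) (min r₀ ρ / 2) η δ (Λ δ) ⊆ Λ^P δ ⊆ Λ δ` eventually — a lattice-polygon
  CONSTRUCTION (zigzag-direction polygonal Jordan curve inside a Jordan domain, exact lattice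
  rounding of its sides), classical but long;
* **(GS) gate stability** — the Carathéodory kernel theorem ON THE SHARED FLAT GATE: for inner
  domains `P_n ⊆ Ω` with the same marked points and the same two flat pieces, exhausting the
  compacts of `Ω`, some conformal frames of the `P_n` have gate densities
  `exp((5/8)(L̄_n − L_{b,n})) = (Φ_n'/Φ_n'(b))^{5/8}` converging to that of `Ω` uniformly on the gate
  segment of radius `ρ/4` (kernel convergence + Schwarz reflection across the gate; Pommerenke,
  Thm. 1.8).

Given (IP) and (GS), `squeeze_of_innerPolygons` proves the stub: the BUDGET half
(`gateLayerBudget_of_innerPolygons`) takes `ε = 1/2`, one inner polygon, the polygon layer budget and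
`gateLayerBudget_of_sandwich`; the PROFILE half (`gateProfile_of_innerPolygons`) runs the
three-epsilon argument `tendsto_of_pinch`: collar avoidance and monotonicity pinch the normalised
gate functional of `Λ` against that of `Λ^P` (`profile_pinch_at`), `PolygonGateProfile` gives the
limit for `Λ^P` with the frame of `P` supplied by (GS) in `ε`–`η` form (`gateStability_eps`), and the
gate integrals of `P` and `Ω` are `ε`-close (`norm_gateIntegral_sub_le`).

Sources: H. Duminil-Copin, S. Smirnov, Ann. of Math. 175 (2012), Conjecture 2; G. Lawler,
O. Schramm, W. Werner (2004) §3.4; Ch. Pommerenke, *Boundary Behaviour of Conformal Maps* (1992),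
Thm. 1.8.  No definition and no named fact is introduced: (IP) and (GS) are hypotheses.
-/

noncomputable section

open scoped BigOperators Topology Classical
open Filter Set MeasureTheory
open Literature.Probability.LatticeModels (HexVertex hexGraph hexCenter)
open Literature.Probability.RandomPlanarGeometry
open Literature.Probability.RandomPlanarGeometry.SAW
open Summit.CriticalPhenomena.SAWScalingLimit.Theorems.PickHalfPlane

namespace Summit.CriticalPhenomena.SAWScalingLimit.Theorems.PolygonParitySqueeze

/-! ### 1. The budget half -/

/-- **Gate layer budget of an admissible family from an inner polygon** (budget half of the
squeeze): with `ε = 1/2` in collar avoidance, one inner exact polygon `P` from (IP), the polygon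
layer budget for `(P, Λ^P)` on `B(pt 1, ρ/4)` and `gateLayerBudget_of_sandwich`.
[cite: LawlerSchrammWerner2004SAW, §3.4 (restriction / boundary scaling heuristics)] -/
theorem gateLayerBudget_of_innerPolygons
    (hAM : (∀ (Λ Λ' : Finset HexVertex), Λ ⊆ Λ' → ∀ (a z : Sym2 HexVertex) (x : ℝ), 0 ≤ x → ‖hexParafermionicObservable Λ a x 0 z‖ ≤ ‖hexParafermionicObservable Λ' a x 0 z‖))
    (hPLB : (∀ (D : DobrushinDomain) (ρ : ℝ) (Λ : ℝ → Finset HexVertex) (m : ℝ → ℤ) (b : ℝ → Sym2 HexVertex), AdmissibleFamily D ρ Λ m b → ExactPolygonFamily D Λ → ∀ (a : ℝ → Sym2 HexVertex) (r₀ : ℝ) (m₀ : ℝ → ℤ), PinnedFlatRoot D Λ b (D.pt 0) a r₀ m₀ → (∀ z ∈ frontier D.carrier, z ≠ D.pt 0 → BoundaryLayerBudgetAt Λ a b z) ∧ (2 * ρ < dist (D.pt 0) (D.pt 1) → GateLayerBudgetAt D (ρ / 2) Λ m a b)))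
    (hGCA : (∀ (D : DobrushinDomain) (ρ : ℝ) (Λ : ℝ → Finset HexVertex) (m : ℝ → ℤ) (b : ℝ → Sym2 HexVertex), AdmissibleFamily D ρ Λ m b → ∀ (a : ℝ → Sym2 HexVertex) (r₀ : ℝ) (m₀ : ℝ → ℤ), PinnedFlatRoot D Λ b (D.pt 0) a r₀ m₀ → CollarAvoidanceAt D ρ Λ a r₀))
    (hIP : (∀ (D : DobrushinDomain) (ρ : ℝ) (Λ : ℝ → Finset HexVertex) (m : ℝ → ℤ) (b : ℝ → Sym2 HexVertex), AdmissibleFamily D ρ Λ m b → ∀ (a : ℝ → Sym2 HexVertex) (r₀ : ℝ) (m₀ : ℝ → ℤ), PinnedFlatRoot D Λ b (D.pt 0) a r₀ m₀ → 2 * ρ < dist (D.pt 0) (D.pt 1) → ∀ η : ℝ, 0 < η → ∃ (P : DobrushinDomain) (ΛP : ℝ → Finset HexVertex), P.pt 0 = D.pt 0 ∧ P.pt 1 = D.pt 1 ∧ P.carrier ⊆ D.carrier ∧ {z : ℂ | z ∈ D.carrier ∧ η ≤ Metric.infDist z D.carrierᶜ} ⊆ P.carrier ∧ AdmissibleFamily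 P (ρ / 2) ΛP m b ∧ ExactPolygonFamily P ΛP ∧ PinnedFlatRoot P ΛP b (P.pt 0) a (min r₀ ρ / 4) m₀ ∧ ∀ᶠ δ : ℝ in 𝓝[>] 0, collarDomain D (3 * ρ / 4) (min r₀ ρ / 2) η δ (Λ δ) ⊆ ΛP δ ∧ ΛP δ ⊆ Λ δ))
    {D : DobrushinDomain} {ρ : ℝ} {Λ : ℝ → Finset HexVertex} {m : ℝ → ℤ} {b : ℝ → Sym2 HexVertex}
    (hAF : AdmissibleFamily D ρ Λ m b) {a : ℝ → Sym2 HexVertex} {r₀ : ℝ} {m₀ : ℝ → ℤ}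
    (hPR : PinnedFlatRoot D Λ b (D.pt 0) a r₀ m₀) (hdist : 2 * ρ < dist (D.pt 0) (D.pt 1)) :
    GateLayerBudgetAt D (ρ / 4) Λ m a b := by
  have hρ : 0 < ρ := hAF.1
  have hr₀ : 0 < r₀ := hPR.1
  have hx₀ : (0 : ℝ) ≤ hexCriticalFugacity := hexCriticalFugacity_pos_lt_one.1.le
  have hmin : 0 < min r₀ ρ := lt_min hr₀ hρ
  have hAFc : AdmissibleFamily D (3 * ρ / 4) Λ m b := admissibleFamily_of_le hAF (by positivity) (by linarith)
  have hPRc : PinnedFlatRoot D Λ b (D.pt 0) a (min r₀ ρ / 2) m₀ :=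
    pinnedFlatRoot_of_le hPR (by positivity) (by linarith [min_le_left r₀ ρ])
  have hCA : CollarAvoidanceAt D (3 * ρ / 4) Λ a (min r₀ ρ / 2) := hGCA D _ Λ m b hAFc a _ m₀ hPRc
  obtain ⟨η, hη, hCAev⟩ := hCA (1 / 2) (by norm_num)
  obtain ⟨P, ΛP, hpt0, hpt1, -, -, hPAF, hPEx, hPPR, hsand⟩ :=
    hIP D ρ Λ m b hAF a r₀ m₀ hPR hdist η hη
  have hdistP : 2 * (ρ / 2) < dist (P.pt 0) (P.pt 1) := by rw [hpt0, hpt1]; linarith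
  have hbudP : GateLayerBudgetAt P (ρ / 2 / 2) ΛP m a b :=
    (hPLB P (ρ / 2) ΛP m b hPAF hPEx a _ m₀ hPPR).2 hdistP
  have hbudD : GateLayerBudgetAt D (ρ / 4) ΛP m a b := by
    unfold GateLayerBudgetAt at hbudP ⊢
    rw [hpt1, show ρ / 2 / 2 = ρ / 4 by ring] at hbudP
    exact hbudP
  -- the pins on `B(pt 1, ρ/2)`
  have hpinΛ : ∀ᶠ δ : ℝ in 𝓝[>] 0, ∀ w : HexVertex,
      (δ : ℂ) * hexCenter w ∈ Metric.ball (D.pt 1) (ρ / 2) → (w ∈ Λ δ ↔ m δ ≤ w.1 1) :=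
    hAF.2.2.1.mono fun δ h w hw => h.2.2.2.2 w (Metric.ball_subset_ball (by linarith) hw)
  have hpinP : ∀ᶠ δ : ℝ in 𝓝[>] 0, ∀ w : HexVertex,
      (δ : ℂ) * hexCenter w ∈ Metric.ball (D.pt 1) (ρ / 2) → (w ∈ ΛP δ ↔ m δ ≤ w.1 1) := by
    have h := hPAF.2.2.1.mono fun δ h => h.2.2.2.2
    rwa [hpt1] at h
  -- masses of `Λ` are at most twice those of `Λ^P` on the gate half-ball
  have hmass : ∀ᶠ δ : ℝ in 𝓝[>] 0, ∀ z ∈ hexDomainMidEdges (Λ δ),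
      (δ : ℂ) * hexMidpoint z ∈ Metric.ball (D.pt 1) (3 * ρ / 4 / 2) →
        ‖hexParafermionicObservable (Λ δ) (a δ) hexCriticalFugacity 0 z‖ ≤
          2 * ‖hexParafermionicObservable (ΛP δ) (a δ) hexCriticalFugacity 0 z‖ := by
    filter_upwards [hCAev, hsand] with δ h1 h2 z hz hball
    have h3 := (h1 z hz hball).trans (hAM _ _ h2.1 (a δ) z _ hx₀)
    linarith
  have hnorm : ∀ᶠ δ : ℝ in 𝓝[>] 0,
      ‖hexParafermionicObservable (ΛP δ) (a δ) hexCriticalFugacity 0 (b δ)‖ ≤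
        ‖hexParafermionicObservable (Λ δ) (a δ) hexCriticalFugacity 0 (b δ)‖ :=
    hsand.mono fun δ h => hAM _ _ h.2 (a δ) (b δ) _ hx₀
  exact gateLayerBudget_of_sandwich (r₂ := ρ / 2) (r₃ := 3 * ρ / 4 / 2) (M := 2) (by linarith)
    (by linarith) (by norm_num) hpinΛ hpinP hmass hnorm hbudD

/-! ### 2. The profile half -/

/-- **Gate profile law of an admissible family from inner polygons** (profile half of the squeeze):
for a conformal frame `(Φ, L, L_b, L̄)` of `D` and a test function `g` supported in `B(pt 1, ρ/4)`,
the normalised gate functional `T_Λ(g)` converges to `∫ g exp((5/8)(L̄ − L_b))`: for every `κ > 0`,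
collar avoidance (`ε`) and gate stability (`ε₁`, (GS) through `gateStability_eps`) choose the collar
width, (IP) an inner polygon `P` with family `Λ^P`, `PolygonGateProfile` the limits of `T_{Λ^P}(g)`
and `T_{Λ^P}(|g|)` in the frame of `P`; `profile_pinch_at` pinches `T_Λ(g)` against `T_{Λ^P}(g)`
and the gate integrals of `P` and `D` differ by `≤ ε₁ ‖g‖_∞ ρ/2` — `tendsto_of_pinch`.
[cite: DuminilCopinSmirnov2012, Conjecture 2 (boundary shadow on the gate)] -/
theorem gateProfile_of_innerPolygons
    (hAM : (∀ (Λ Λ' : Finset HexVertex), Λ ⊆ Λ' → ∀ (a z : Sym2 HexVertex) (x : ℝ), 0 ≤ x → ‖hexParafermionicObservable Λ a x 0 z‖ ≤ ‖hexParafermionicObservable Λ' a x 0 z‖))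
    (hPGP : (∀ (D : DobrushinDomain) (ρ : ℝ) (Λ : ℝ → Finset HexVertex) (m : ℝ → ℤ) (b : ℝ → Sym2 HexVertex), AdmissibleFamily D ρ Λ m b → ExactPolygonFamily D Λ → ∀ (a : ℝ → Sym2 HexVertex) (r₀ : ℝ) (m₀ : ℝ → ℤ), PinnedFlatRoot D Λ b (D.pt 0) a r₀ m₀ → 2 * ρ < dist (D.pt 0) (D.pt 1) → GateProfileAt D ρ (ρ / 2) Λ a b))
    (hGCA : (∀ (D : DobrushinDomain) (ρ : ℝ) (Λ : ℝ → Finset HexVertex) (m : ℝ → ℤ) (b : ℝ → Sym2 HexVertex), AdmissibleFamily D ρ Λ m b → ∀ (a : ℝ → Sym2 HexVertex) (r₀ : ℝ) (m₀ : ℝ → ℤ), PinnedFlatRoot D Λ b (D.pt 0) a r₀ m₀ → CollarAvoidanceAt D ρ Λ a r₀))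
    (hIP : (∀ (D : DobrushinDomain) (ρ : ℝ) (Λ : ℝ → Finset HexVertex) (m : ℝ → ℤ) (b : ℝ → Sym2 HexVertex), AdmissibleFamily D ρ Λ m b → ∀ (a : ℝ → Sym2 HexVertex) (r₀ : ℝ) (m₀ : ℝ → ℤ), PinnedFlatRoot D Λ b (D.pt 0) a r₀ m₀ → 2 * ρ < dist (D.pt 0) (D.pt 1) → ∀ η : ℝ, 0 < η → ∃ (P : DobrushinDomain) (ΛP : ℝ → Finset HexVertex), P.pt 0 = D.pt 0 ∧ P.pt 1 = D.pt 1 ∧ P.carrier ⊆ D.carrier ∧ {z : ℂ | z ∈ D.carrier ∧ η ≤ Metric.infDist z D.carrierᶜ} ⊆ P.carrier ∧ AdmissibleFamily P (ρ / 2) ΛP m b ∧ ExactPolygonFamily P ΛP ∧ PinnedFlatRoot P ΛP b (P.pt 0) a (min r₀ ρ / 4) m₀ ∧ ∀ᶠ δ : ℝ in 𝓝[>] 0, collarDomain D (3 * ρ / 4) (min r₀ ρ / 2) η δ (Λ δ) ⊆ ΛP δ ∧ ΛP δ ⊆ Λ δ))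
    (hGS : (∀ (D : DobrushinDomain) (ρ r₀ r' : ℝ), 0 < ρ → 0 < r' → r' ≤ r₀ → D.carrier ∩ Metric.ball (D.pt 1) ρ = {z : ℂ | (D.pt 1).im < z.im} ∩ Metric.ball (D.pt 1) ρ → D.carrier ∩ Metric.ball (D.pt 0) r₀ = {z : ℂ | (D.pt 0).im < z.im} ∩ Metric.ball (D.pt 0) r₀ → 2 * ρ < dist (D.pt 0) (D.pt 1) → ∀ (Φ : ConformalEquiv D.carrier UpperHalfPlane.upperHalfPlaneSet) (L : ℂ → ℂ) (Lb : ℂ), ConformalFrame D Φ L Lb → ∀ (Lbar : ℂ → ℂ), ContinuousOn Lbar (D.carrier ∪ gateSeg D ρ) → EqOn Lbar L D.carrier → ∀ (P : ℕ → DobrushinDomain), (∀ n, (P n).pt 0 = D.pt 0 ∧ (P n).pt 1 = D.pt 1 ∧ (P n).carrier ⊆ D.carrier ∧ (P n).carrier ∩ Metric.ball (D.pt 1) (ρ / 2) = {z : ℂ | (D.pt 1).im < z.im} ∩ Metric.ball (D.pt 1) (ρ / 2) ∧ (P n).carrier ∩ Metric.ball (D.pt 0) r' = {z : ℂ | (D.pt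 0).im < z.im} ∩ Metric.ball (D.pt 0) r') → (∀ K : Set ℂ, IsCompact K → K ⊆ D.carrier → ∀ᶠ n : ℕ in atTop, K ⊆ (P n).carrier) → ∃ (ΦP : (n : ℕ) → ConformalEquiv (P n).carrier UpperHalfPlane.upperHalfPlaneSet) (LP : ℕ → ℂ → ℂ) (LbP : ℕ → ℂ) (LbarP : ℕ → ℂ → ℂ), (∀ n, ConformalFrame (P n) (ΦP n) (LP n) (LbP n) ∧ ContinuousOn (LbarP n) ((P n).carrier ∪ gateSeg (P n) (ρ / 2)) ∧ EqOn (LbarP n) (LP n) (P n).carrier) ∧ TendstoUniformlyOn (fun n x => Complex.exp ((5 / 8 : ℂ) * (LbarP n x - LbP n))) (fun x => Complex.exp ((5 / 8 : ℂ) * (Lbar x - Lb))) atTop (gateSeg D (ρ / 4))))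
    {D : DobrushinDomain} {ρ : ℝ} {Λ : ℝ → Finset HexVertex} {m : ℝ → ℤ} {b : ℝ → Sym2 HexVertex}
    (hAF : AdmissibleFamily D ρ Λ m b) {a : ℝ → Sym2 HexVertex} {r₀ : ℝ} {m₀ : ℝ → ℤ}
    (hPR : PinnedFlatRoot D Λ b (D.pt 0) a r₀ m₀) (hdist : 2 * ρ < dist (D.pt 0) (D.pt 1)) :
    GateProfileAt D ρ (ρ / 4) Λ a b := by
  intro Φ L Lb hCF Lbar hLbar hEq g hg hgs hsupp
  have hρ : 0 < ρ := hAF.1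
  have hr₀ : 0 < r₀ := hPR.1
  have hx₀ : (0 : ℝ) ≤ hexCriticalFugacity := hexCriticalFugacity_pos_lt_one.1.le
  have hmin : 0 < min r₀ ρ := lt_min hr₀ hρ
  have hAFc : AdmissibleFamily D (3 * ρ / 4) Λ m b := admissibleFamily_of_le hAF (by positivity) (by linarith)
  have hPRc : PinnedFlatRoot D Λ b (D.pt 0) a (min r₀ ρ / 2) m₀ :=
    pinnedFlatRoot_of_le hPR (by positivity) (by linarith [min_le_left r₀ ρ])
  have hCA : CollarAvoidanceAt D (3 * ρ / 4) Λ a (min r₀ ρ / 2) := hGCA D _ Λ m b hAFc a _ m₀ hPRc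
  -- the `ε`–`η` gate stability for this datum and this frame
  have hGSε := gateStability_eps (D := D) (ρ := ρ) (r' := min r₀ ρ / 4) (Lbar := Lbar) (Lb := Lb)
    (hGS D ρ r₀ (min r₀ ρ / 4) hρ (by positivity) (by linarith [min_le_left r₀ ρ]) hAF.2.1 hPR.2.1
      hdist Φ L Lb hCF Lbar hLbar hEq)
  -- a bound on the test function
  obtain ⟨Mg₀, hMg₀⟩ := hgs.exists_bound_of_continuous hg
  set Mg : ℝ := max Mg₀ 0 + 1 with hMgdef
  have hMgpos : 0 < Mg := by positivity
  have hMg : ∀ z, ‖g z‖ ≤ Mg := fun z => (hMg₀ z).trans (by linarith [le_max_left Mg₀ 0])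
  -- the gate density of `D` and a bound for it on the gate interval
  set dD : ℝ → ℂ := fun x => Complex.exp ((5 / 8 : ℂ) *
    (Lbar ((x : ℂ) + ((D.pt 1).im : ℂ) * Complex.I) - Lb)) with hdD
  have hdDcont : ContinuousOn dD (Set.Icc ((D.pt 1).re - ρ / 4) ((D.pt 1).re + ρ / 4)) :=
    continuousOn_gateDensity D Lb hLbar (by linarith)
  obtain ⟨BD₀, hBD₀⟩ := isCompact_Icc.exists_bound_of_continuousOn hdDcont
  set BD : ℝ := max BD₀ 0 with hBDdef
  have hBD : ∀ x ∈ Set.Icc ((D.pt 1).re - ρ / 4) ((D.pt 1).re + ρ / 4), ‖dD x‖ ≤ BD := fun x hx =>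
    (hBD₀ x hx).trans (le_max_left _ _)
  -- the weight on the gate line
  set G : ℝ → ℂ := fun x => g ((x : ℂ) + ((D.pt 1).im : ℂ) * Complex.I) with hG
  have hGcont : Continuous G := hg.comp (by fun_prop)
  -- the test function `|g|`
  set ga : ℂ → ℂ := fun z => ((‖g z‖ : ℝ) : ℂ) with hga
  have hga_cont : Continuous ga := Complex.continuous_ofReal.comp hg.norm
  have hga_supp_sub : Function.support ga ⊆ Function.support g := by
    intro z hz
    simp only [Function.mem_support, ne_eq, hga, Complex.ofReal_eq_zero, norm_eq_zero] at hz ⊢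
    exact hz
  have hga_cs : HasCompactSupport ga := hgs.mono hga_supp_sub
  have hga_tsupp : tsupport ga ⊆ Metric.ball (D.pt 1) (ρ / 4) :=
    (closure_mono hga_supp_sub).trans hsupp
  -- the three-epsilon argument
  refine tendsto_of_pinch fun κ hκ => ?_
  -- constants
  set X : ℝ := Mg * (ρ / 2) with hX
  have hXnn : 0 ≤ X := by positivity
  set ε₁ : ℝ := κ / (4 * (X + 1)) with hε₁
  have hε₁pos : 0 < ε₁ := by positivity
  have hε₁le : Mg * ε₁ * (2 * (ρ / 4)) ≤ κ / 4 := by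
    have h1 : Mg * ε₁ * (2 * (ρ / 4)) = X * κ / (4 * (X + 1)) := by rw [hε₁, hX]; ring
    rw [h1, div_le_div_iff₀ (by positivity) (by positivity)]
    nlinarith
  set A₁ : ℝ := Mg * (BD + ε₁) * (2 * (ρ / 4)) with hA₁
  have hA₁nn : 0 ≤ A₁ := by positivity
  set ε : ℝ := min (1 / 2) (κ / (16 * (A₁ + 1))) with hεdef
  have hε0 : 0 < ε := lt_min (by norm_num) (by positivity)
  have hεhalf : ε ≤ 1 / 2 := min_le_left _ _
  have hε1 : ε < 1 := by linarith
  set θ : ℝ := ε / (1 - ε) ^ 2 with hθdef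
  have hθ : 0 ≤ θ := div_nonneg hε0.le (sq_nonneg _)
  have hθle : θ ≤ 4 * ε := by
    have h14 : (1 / 4 : ℝ) ≤ (1 - ε) ^ 2 := by nlinarith
    calc θ ≤ ε / (1 / 4) := div_le_div_of_nonneg_left hε0.le (by norm_num) h14
      _ = 4 * ε := by ring
  have hθA : θ * (A₁ + 1) ≤ κ / 4 := by
    have h1 : ε ≤ κ / (16 * (A₁ + 1)) := min_le_right _ _
    calc θ * (A₁ + 1) ≤ 4 * (κ / (16 * (A₁ + 1))) * (A₁ + 1) := by
          apply mul_le_mul_of_nonneg_right _ (by positivity)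
          linarith
      _ = κ / 4 := by field_simp; ring
  -- collar widths
  obtain ⟨η₁, hη₁, hGSP⟩ := hGSε ε₁ hε₁pos
  obtain ⟨η₂, hη₂, hCAev⟩ := hCA ε hε0
  -- the inner polygon
  obtain ⟨P, ΛP, hpt0, hpt1, hPD, hDη, hPAF, hPEx, hPPR, hsand⟩ :=
    hIP D ρ Λ m b hAF a r₀ m₀ hPR hdist (min η₁ η₂) (lt_min hη₁ hη₂)
  -- its frame, `ε₁`-close on the gate
  have hPflat1 : P.carrier ∩ Metric.ball (D.pt 1) (ρ / 2) =
      {z : ℂ | (D.pt 1).im < z.im} ∩ Metric.ball (D.pt 1) (ρ / 2) := by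
    have h := hPAF.2.1; rwa [hpt1] at h
  have hPflat0 : P.carrier ∩ Metric.ball (D.pt 0) (min r₀ ρ / 4) =
      {z : ℂ | (D.pt 0).im < z.im} ∩ Metric.ball (D.pt 0) (min r₀ ρ / 4) := by
    have h := hPPR.2.1; rwa [hpt0] at h
  obtain ⟨ΦP, LP, LbP, LbarP, hCFP, hLbarP, hEqP, hclose⟩ := hGSP P hpt0 hpt1 hPD hPflat1 hPflat0
    ((etaInterior_anti (min_le_left η₁ η₂)).trans hDη)
  -- the gate profile law of `(P, Λ^P)` at radius `ρ/4`, in the frame of `P`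
  have hdistP : 2 * (ρ / 2) < dist (P.pt 0) (P.pt 1) := by rw [hpt0, hpt1]; linarith
  have hGP : GateProfileAt P (ρ / 2) (ρ / 4) ΛP a b := by
    have h := hPGP P (ρ / 2) ΛP m b hPAF hPEx a _ m₀ hPPR hdistP
    rwa [show ρ / 2 / 2 = ρ / 4 by ring] at h
  have hsuppP : tsupport g ⊆ Metric.ball (P.pt 1) (ρ / 4) := by rw [hpt1]; exact hsupp
  have hga_tsuppP : tsupport ga ⊆ Metric.ball (P.pt 1) (ρ / 4) := by rw [hpt1]; exact hga_tsupp
  have hTP := hGP ΦP LP LbP hCFP LbarP hLbarP hEqP g hg hgs hsuppP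
  have hTPa := hGP ΦP LP LbP hCFP LbarP hLbarP hEqP ga hga_cont hga_cs hga_tsuppP
  -- the gate density of `P`
  have hdPcont : ContinuousOn (fun x : ℝ => Complex.exp ((5 / 8 : ℂ) *
      (LbarP ((x : ℂ) + ((D.pt 1).im : ℂ) * Complex.I) - LbP)))
      (Set.Icc ((D.pt 1).re - ρ / 4) ((D.pt 1).re + ρ / 4)) := by
    have h := continuousOn_gateDensity P LbP hLbarP (show ρ / 4 < ρ / 2 by linarith)
    rwa [hpt1] at h
  rw [hpt1] at hTP hTPa
  -- pointwise closeness of the densities on the open gate interval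
  have hclose' : ∀ x ∈ Set.Ioo ((D.pt 1).re - ρ / 4) ((D.pt 1).re + ρ / 4),
      ‖Complex.exp ((5 / 8 : ℂ) * (LbarP ((x : ℂ) + ((D.pt 1).im : ℂ) * Complex.I) - LbP)) -
        dD x‖ ≤ ε₁ := by
    intro x hx
    refine hclose _ (gatePoint_mem_gateSeg D ?_)
    rw [abs_lt]; constructor <;> linarith [hx.1, hx.2]
  -- the pins on `B(pt 1, ρ/2)` and the sandwich on the gate half-ball
  have hpinΛ : ∀ᶠ δ : ℝ in 𝓝[>] 0, ∀ w : HexVertex,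
      (δ : ℂ) * hexCenter w ∈ Metric.ball (D.pt 1) (ρ / 2) → (w ∈ Λ δ ↔ m δ ≤ w.1 1) :=
    hAF.2.2.1.mono fun δ h w hw => h.2.2.2.2 w (Metric.ball_subset_ball (by linarith) hw)
  have hpinP : ∀ᶠ δ : ℝ in 𝓝[>] 0, ∀ w : HexVertex,
      (δ : ℂ) * hexCenter w ∈ Metric.ball (D.pt 1) (ρ / 2) → (w ∈ ΛP δ ↔ m δ ≤ w.1 1) := by
    have h := hPAF.2.2.1.mono fun δ h => h.2.2.2.2
    rwa [hpt1] at h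
  have hsw : ∀ᶠ δ : ℝ in 𝓝[>] 0, ∀ z ∈ hexDomainMidEdges (Λ δ),
      (δ : ℂ) * hexMidpoint z ∈ Metric.ball (D.pt 1) (3 * ρ / 4 / 2) →
        (1 - ε) * ‖hexParafermionicObservable (Λ δ) (a δ) hexCriticalFugacity 0 z‖ ≤
            ‖hexParafermionicObservable (ΛP δ) (a δ) hexCriticalFugacity 0 z‖ ∧
          ‖hexParafermionicObservable (ΛP δ) (a δ) hexCriticalFugacity 0 z‖ ≤
            ‖hexParafermionicObservable (Λ δ) (a δ) hexCriticalFugacity 0 z‖ := by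
    filter_upwards [hCAev, hsand] with δ h1 h2 z hz hball
    have hmono : collarDomain D (3 * ρ / 4) (min r₀ ρ / 2) η₂ δ (Λ δ) ⊆
        collarDomain D (3 * ρ / 4) (min r₀ ρ / 2) (min η₁ η₂) δ (Λ δ) := by
      intro v hv
      obtain ⟨hvΛ, hc⟩ := Finset.mem_filter.1 hv
      exact Finset.mem_filter.2 ⟨hvΛ, hc.imp (fun h => (min_le_right η₁ η₂).trans h) id⟩
    exact ⟨(h1 z hz hball).trans (hAM _ _ (hmono.trans h2.1) (a δ) z _ hx₀),
      hAM _ _ h2.2 (a δ) z _ hx₀⟩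
  have hbnear : ∀ᶠ δ : ℝ in 𝓝[>] 0,
      (δ : ℂ) * hexMidpoint (b δ) ∈ Metric.ball (D.pt 1) (3 * ρ / 4 / 2) :=
    hAF.2.2.2.2 (Metric.ball_mem_nhds _ (by positivity))
  have hδev : ∀ᶠ δ : ℝ in 𝓝[>] 0, δ ∈ Set.Ioo 0 (ρ / 4) := Ioo_mem_nhdsGT (by positivity)
  refine ⟨_, _, _, _, θ, hθ, ?_, hTP, hTPa, ?_, ?_⟩
  · -- the eventual pinch `‖T_Λ(g) - T_P(g)‖ ≤ θ ‖T_P(|g|)‖`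
    filter_upwards [hpinΛ, hpinP, hsw, hbnear, hδev, hAF.2.2.1, hPR.2.2.1]
      with δ hpinδ hpinδ' hswδ hbδ hδ hAFδ hPRδ
    have hbΛ : b δ ∈ hexDomainBoundary (Λ δ) := hAFδ.2.1
    have hbpos : 0 < ‖hexParafermionicObservable (Λ δ) (a δ) hexCriticalFugacity 0 (b δ)‖ :=
      (GateMass.norm_obs_zero_pos_iff _ _ _).2 hPRδ.2.1
    have hbs := hswδ (b δ) (hexDomainBoundary_subset _ hbΛ) hbδ
    refine profile_pinch_at (m := m δ) (r₂ := ρ / 2) g hδ.1.le hε0.le hε1 hpinδ hpinδ' ?_ hbpos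
      hbs.1 hbs.2 ?_
    · intro z hz
      have : dist z (D.pt 1) < ρ / 4 := hz
      linarith [hδ.2]
    · intro z hz hball
      exact hswδ z (hexDomainBoundary_subset _ hz) (Metric.ball_subset_ball (by linarith) hball)
  · -- `θ (‖I_P(|g|)‖ + 1) ≤ κ/4`
    refine le_trans (mul_le_mul_of_nonneg_left ?_ hθ) hθA
    refine add_le_add (norm_gateIntegral_le (x₁ := (D.pt 1).re) (r := ρ / 4)
      (by positivity) fun x hx => ?_) le_rfl
    rw [norm_mul, Complex.norm_real, norm_norm]
    refine mul_le_mul (hMg _) ?_ (norm_nonneg _) hMgpos.le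
    have h1 := hclose' x hx
    have h2 := hBD x (Set.Ioo_subset_Icc_self hx)
    have h3 := norm_le_norm_add_norm_sub' (Complex.exp ((5 / 8 : ℂ) *
      (LbarP ((x : ℂ) + ((D.pt 1).im : ℂ) * Complex.I) - LbP))) (dD x)
    linarith
  · -- `‖I_P(g) - I_D(g)‖ ≤ κ/4`
    refine le_trans ?_ hε₁le
    refine norm_gateIntegral_sub_le (F := fun x => G x * dD x)
      (F' := fun x => G x * Complex.exp ((5 / 8 : ℂ) *
        (LbarP ((x : ℂ) + ((D.pt 1).im : ℂ) * Complex.I) - LbP)))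
      (by positivity) (integrableOn_gate hGcont hdDcont) (integrableOn_gate hGcont hdPcont) ?_
    intro x hx
    rw [← mul_sub, norm_mul]
    exact mul_le_mul (hMg _) (hclose' x hx) (norm_nonneg _) hMgpos.le

/-! ### 3. The stub, from (IP) and (GS) -/

/-- **The registered stub `stub_squeeze` from (IP) and (GS).**  The statement after the two
displayed hypotheses is the registered header of `stub_squeeze`
(`ArrivalMonotone → PolygonGateProfile → PolygonPackage → GateCollarAvoidance → GateData`), verbatim.
[cite: DuminilCopinSmirnov2012, Conjecture 2 (boundary shadow on the gate)] -/
theorem squeeze_of_innerPolygons : (∀ (D : DobrushinDomain) (ρ : ℝ) (Λ : ℝ → Finset HexVertex) (m : ℝ → ℤ) (b : ℝ → Sym2 HexVertex), AdmissibleFamily D ρ Λ m b → ∀ (a : ℝ → Sym2 HexVertex) (r₀ : ℝ) (m₀ : ℝ → ℤ), PinnedFlatRoot D Λ b (D.pt 0) a r₀ m₀ → 2 * ρ < dist (D.pt 0) (D.pt 1) → ∀ η : ℝ, 0 < η → ∃ (P : DobrushinDomain) (ΛP : ℝ → Finset HexVertex), P.pt 0 = D.pt 0 ∧ P.pt 1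 = D.pt 1 ∧ P.carrier ⊆ D.carrier ∧ {z : ℂ | z ∈ D.carrier ∧ η ≤ Metric.infDist z D.carrierᶜ} ⊆ P.carrier ∧ AdmissibleFamily P (ρ / 2) ΛP m b ∧ ExactPolygonFamily P ΛP ∧ PinnedFlatRoot P ΛP b (P.pt 0) a (min r₀ ρ / 4) m₀ ∧ ∀ᶠ δ : ℝ in 𝓝[>] 0, collarDomain D (3 * ρ / 4) (min r₀ ρ / 2) η δ (Λ δ) ⊆ ΛP δ ∧ ΛP δ ⊆ Λ δ) → (∀ (D : DobrushinDomain) (ρ r₀ r' : ℝ), 0 < ρ → 0 < r' → r' ≤ r₀ → D.carrier ∩ Metric.ball (D.pt 1) ρ = {z : ℂ | (D.pt 1).im < z.im} ∩ Metric.ball (D.pt 1) ρ → D.carrier ∩ Metric.ball (D.pt 0) r₀ = {z : ℂ | (D.pt 0).im < z.im} ∩ Metric.ball (D.pt 0) r₀ → 2 * ρ < dist (D.pt 0) (D.pt 1) → ∀ (Φ : ConformalEquiv D.carrier UpperHalfPlane.upperHalfPlaneSet) (L : ℂ → ℂ) (Lb : ℂ), ConformalFrame D Φ L Lb → ∀ (Lbar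 : ℂ → ℂ), ContinuousOn Lbar (D.carrier ∪ gateSeg D ρ) → EqOn Lbar L D.carrier → ∀ (P : ℕ → DobrushinDomain), (∀ n, (P n).pt 0 = D.pt 0 ∧ (P n).pt 1 = D.pt 1 ∧ (P n).carrier ⊆ D.carrier ∧ (P n).carrier ∩ Metric.ball (D.pt 1) (ρ / 2) = {z : ℂ | (D.pt 1).im < z.im} ∩ Metric.ball (D.pt 1) (ρ / 2) ∧ (P n).carrier ∩ Metric.ball (D.pt 0) r' = {z : ℂ | (D.pt 0).im < z.im} ∩ Metric.ball (D.pt 0) r') → (∀ K : Set ℂ, IsCompact K → K ⊆ D.carrier → ∀ᶠ n : ℕ in atTop, K ⊆ (P n).carrier) → ∃ (ΦP : (n : ℕ) → ConformalEquiv (P n).carrier UpperHalfPlane.upperHalfPlaneSet) (LP : ℕ → ℂ → ℂ) (LbP : ℕ → ℂ) (LbarP : ℕ → ℂ → ℂ), (∀ n, ConformalFrame (P n) (ΦP n) (LP n) (LbP n) ∧ ContinuousOn (LbarP n) ((P n).carrier ∪ gateSeg (P n) (ρ / 2)) ∧ EqOn (LbarP n) (LP n) (P n).carrier) ∧ TendstoUniformlyOn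 (fun n x => Complex.exp ((5 / 8 : ℂ) * (LbarP n x - LbP n))) (fun x => Complex.exp ((5 / 8 : ℂ) * (Lbar x - Lb))) atTop (gateSeg D (ρ / 4))) → (∀ (Λ Λ' : Finset HexVertex), Λ ⊆ Λ' → ∀ (a z : Sym2 HexVertex) (x : ℝ), 0 ≤ x → ‖hexParafermionicObservable Λ a x 0 z‖ ≤ ‖hexParafermionicObservable Λ' a x 0 z‖) → (∀ (D : DobrushinDomain) (ρ : ℝ) (Λ : ℝ → Finset HexVertex) (m : ℝ → ℤ) (b : ℝ → Sym2 HexVertex), AdmissibleFamily D ρ Λ m b → ExactPolygonFamily D Λ → ∀ (a : ℝ → Sym2 HexVertex) (r₀ : ℝ) (m₀ : ℝ → ℤ), PinnedFlatRoot D Λ b (D.pt 0) a r₀ m₀ → 2 * ρ < dist (D.pt 0) (D.pt 1) → GateProfileAt D ρ (ρ / 2) Λ a b) → ((∀ (D : DobrushinDomain) (ρ : ℝ) (Λ : ℝ → Finset HexVertex) (m : ℝ → ℤ) (b : ℝ → Sym2 HexVertex), AdmissibleFamily D ρ Λ m b → ExactPolygonFamily D Λ → ∀ (a : ℝ → Sym2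 HexVertex) (r₀ : ℝ) (m₀ : ℝ → ℤ), PinnedFlatRoot D Λ b (D.pt 0) a r₀ m₀ → (∀ K : Set ℂ, IsCompact K → K ⊆ closure D.carrier → D.pt 0 ∉ K → L1BoundOn Λ a b K) ∧ RootTightAt Λ a b (D.pt 0)) ∧ (∀ (D : DobrushinDomain) (ρ : ℝ) (Λ : ℝ → Finset HexVertex) (m : ℝ → ℤ) (b : ℝ → Sym2 HexVertex), AdmissibleFamily D ρ Λ m b → ExactPolygonFamily D Λ → ∀ (a : ℝ → Sym2 HexVertex) (r₀ : ℝ) (m₀ : ℝ → ℤ), PinnedFlatRoot D Λ b (D.pt 0) a r₀ m₀ → (∀ z ∈ frontier D.carrier, z ≠ D.pt 0 → BoundaryLayerBudgetAt Λ a b z) ∧ (2 * ρ < dist (D.pt 0) (D.pt 1) → GateLayerBudgetAt D (ρ / 2) Λ m a b)) ∧ (∀ (D : DobrushinDomain) (ρ : ℝ) (Λ : ℝ → Finset HexVertex) (m : ℝ → ℤ) (b : ℝ → Sym2 HexVertex), AdmissibleFamily D ρ Λ m b → ExactPolygonFamily D Λ → ∀ (a : ℝ → Sym2 HexVertex) (r₀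 : ℝ) (m₀ : ℝ → ℤ), PinnedFlatRoot D Λ b (D.pt 0) a r₀ m₀ → RatioMixingAt Λ a b)) → (∀ (D : DobrushinDomain) (ρ : ℝ) (Λ : ℝ → Finset HexVertex) (m : ℝ → ℤ) (b : ℝ → Sym2 HexVertex), AdmissibleFamily D ρ Λ m b → ∀ (a : ℝ → Sym2 HexVertex) (r₀ : ℝ) (m₀ : ℝ → ℤ), PinnedFlatRoot D Λ b (D.pt 0) a r₀ m₀ → CollarAvoidanceAt D ρ Λ a r₀) → ∀ (D : DobrushinDomain) (ρ : ℝ) (Λ : ℝ → Finset HexVertex) (m : ℝ → ℤ) (b : ℝ → Sym2 HexVertex), AdmissibleFamily D ρ Λ m b → ∀ (a : ℝ → Sym2 HexVertex) (r₀ : ℝ) (m₀ : ℝ → ℤ), PinnedFlatRoot D Λ b (D.pt 0) a r₀ m₀ → 2 * ρ < dist (D.pt 0) (D.pt 1) → GateProfileAt D ρ (ρ / 4) Λ a b ∧ GateLayerBudgetAt D (ρ / 4) Λ m a b :=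
  fun hIP hGS hAM hPGP hPP hGCA _ _ _ _ _ hAF _ _ _ hPR hdist =>
    ⟨gateProfile_of_innerPolygons hAM hPGP hGCA hIP hGS hAF hPR hdist,
      gateLayerBudget_of_innerPolygons hAM hPP.2.1 hGCA hIP hAF hPR hdist⟩

/-! ### Registered forms (sub-goals of `stub_squeeze`) -/

/-- **Registered sub-goal `squeeze_reductionBudget`** (crux item stmt-CriticalPhenomena-14004, line
`polygon-parity-squeeze`, stub `stub_squeeze`): the budget half of `GateData` for one admissible pinned
datum, from (IP), domain monotonicity, the polygon layer budget and gate collar avoidance.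
[cite: LawlerSchrammWerner2004SAW, §3.4 (restriction / boundary scaling heuristics)] -/
theorem squeeze_reductionBudget : (∀ (D : DobrushinDomain) (ρ : ℝ) (Λ : ℝ → Finset HexVertex) (m : ℝ → ℤ) (b : ℝ → Sym2 HexVertex), AdmissibleFamily D ρ Λ m b → ∀ (a : ℝ → Sym2 HexVertex) (r₀ : ℝ) (m₀ : ℝ → ℤ), PinnedFlatRoot D Λ b (D.pt 0) a r₀ m₀ → 2 * ρ < dist (D.pt 0) (D.pt 1) → ∀ η : ℝ, 0 < η → ∃ (P : DobrushinDomain) (ΛP : ℝ → Finset HexVertex), P.pt 0 = D.pt 0 ∧ P.pt 1 = D.pt 1 ∧ P.carrier ⊆ D.carrier ∧ {z : ℂ | z ∈ D.carrier ∧ η ≤ Metric.infDist z D.carrierᶜ} ⊆ P.carrier ∧ AdmissibleFamily P (ρ / 2) ΛP m b ∧ ExactPolygonFamily P ΛP ∧ PinnedFlatRoot P ΛP b (P.pt 0) a (min r₀ ρ / 4) m₀ ∧ ∀ᶠ δ : ℝ in 𝓝[>] 0, collarDomain D (3 * ρ / 4) (min r₀ ρ / 2) η δ (Λ δ) ⊆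 ΛP δ ∧ ΛP δ ⊆ Λ δ) → (∀ (Λ Λ' : Finset HexVertex), Λ ⊆ Λ' → ∀ (a z : Sym2 HexVertex) (x : ℝ), 0 ≤ x → ‖hexParafermionicObservable Λ a x 0 z‖ ≤ ‖hexParafermionicObservable Λ' a x 0 z‖) → (∀ (D : DobrushinDomain) (ρ : ℝ) (Λ : ℝ → Finset HexVertex) (m : ℝ → ℤ) (b : ℝ → Sym2 HexVertex), AdmissibleFamily D ρ Λ m b → ExactPolygonFamily D Λ → ∀ (a : ℝ → Sym2 HexVertex) (r₀ : ℝ) (m₀ : ℝ → ℤ), PinnedFlatRoot D Λ b (D.pt 0) a r₀ m₀ → (∀ z ∈ frontier D.carrier, z ≠ D.pt 0 → BoundaryLayerBudgetAt Λ a b z) ∧ (2 * ρ < dist (D.pt 0) (D.pt 1) → GateLayerBudgetAt D (ρ / 2) Λ m a b)) → (∀ (D : DobrushinDomain) (ρ : ℝ) (Λ : ℝ → Finset HexVertex) (m : ℝ → ℤ) (b : ℝ → Sym2 HexVertex), AdmissibleFamily D ρ Λ m b → ∀ (a : ℝ → Sym2 HexVertex) (r₀ : ℝ) (m₀ : ℝ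 → ℤ), PinnedFlatRoot D Λ b (D.pt 0) a r₀ m₀ → CollarAvoidanceAt D ρ Λ a r₀) → ∀ (D : DobrushinDomain) (ρ : ℝ) (Λ : ℝ → Finset HexVertex) (m : ℝ → ℤ) (b : ℝ → Sym2 HexVertex), AdmissibleFamily D ρ Λ m b → ∀ (a : ℝ → Sym2 HexVertex) (r₀ : ℝ) (m₀ : ℝ → ℤ), PinnedFlatRoot D Λ b (D.pt 0) a r₀ m₀ → 2 * ρ < dist (D.pt 0) (D.pt 1) → GateLayerBudgetAt D (ρ / 4) Λ m a b :=
  fun hIP hAM hPLB hGCA _ _ _ _ _ hAF _ _ _ hPR hdist =>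
    gateLayerBudget_of_innerPolygons hAM hPLB hGCA hIP hAF hPR hdist

/-- **Registered sub-goal `squeeze_reductionProfile`** (crux item stmt-CriticalPhenomena-14004, line
`polygon-parity-squeeze`, stub `stub_squeeze`): the profile half of `GateData` for one admissible
pinned datum, from (IP), (GS), domain monotonicity, the polygon gate profile law and gate collar
avoidance. [cite: DuminilCopinSmirnov2012, Conjecture 2 (boundary shadow on the gate)] -/
theorem squeeze_reductionProfile : (∀ (D : DobrushinDomain) (ρ : ℝ) (Λ : ℝ → Finset HexVertex) (m : ℝ → ℤ) (b : ℝ → Sym2 HexVertex), AdmissibleFamily D ρ Λ m b → ∀ (a : ℝ → Sym2 HexVertex) (r₀ : ℝ) (m₀ : ℝ → ℤ), PinnedFlatRoot D Λ b (D.pt 0) a r₀ m₀ → 2 * ρ < dist (D.pt 0) (D.pt 1) → ∀ η : ℝ, 0 < η → ∃ (P : DobrushinDomain) (ΛP : ℝ → Finset HexVertex), P.pt 0 = D.pt 0 ∧ P.pt 1 = D.pt 1 ∧ P.carrier ⊆ D.carrier ∧ {z : ℂ | z ∈ D.carrier ∧ η ≤ Metric.infDist z D.carrierᶜ} ⊆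 P.carrier ∧ AdmissibleFamily P (ρ / 2) ΛP m b ∧ ExactPolygonFamily P ΛP ∧ PinnedFlatRoot P ΛP b (P.pt 0) a (min r₀ ρ / 4) m₀ ∧ ∀ᶠ δ : ℝ in 𝓝[>] 0, collarDomain D (3 * ρ / 4) (min r₀ ρ / 2) η δ (Λ δ) ⊆ ΛP δ ∧ ΛP δ ⊆ Λ δ) → (∀ (D : DobrushinDomain) (ρ r₀ r' : ℝ), 0 < ρ → 0 < r' → r' ≤ r₀ → D.carrier ∩ Metric.ball (D.pt 1) ρ = {z : ℂ | (D.pt 1).im < z.im} ∩ Metric.ball (D.pt 1) ρ → D.carrier ∩ Metric.ball (D.pt 0) r₀ = {z : ℂ | (D.pt 0).im < z.im} ∩ Metric.ball (D.pt 0) r₀ → 2 * ρ < dist (D.pt 0) (D.pt 1) → ∀ (Φ : ConformalEquiv D.carrier UpperHalfPlane.upperHalfPlaneSet) (L : ℂ → ℂ) (Lb : ℂ), ConformalFrame D Φ L Lb → ∀ (Lbar : ℂ → ℂ), ContinuousOn Lbar (D.carrier ∪ gateSeg D ρ) → EqOn Lbar L D.carrier → ∀ (P : ℕ → DobrushinDomain),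 (∀ n, (P n).pt 0 = D.pt 0 ∧ (P n).pt 1 = D.pt 1 ∧ (P n).carrier ⊆ D.carrier ∧ (P n).carrier ∩ Metric.ball (D.pt 1) (ρ / 2) = {z : ℂ | (D.pt 1).im < z.im} ∩ Metric.ball (D.pt 1) (ρ / 2) ∧ (P n).carrier ∩ Metric.ball (D.pt 0) r' = {z : ℂ | (D.pt 0).im < z.im} ∩ Metric.ball (D.pt 0) r') → (∀ K : Set ℂ, IsCompact K → K ⊆ D.carrier → ∀ᶠ n : ℕ in atTop, K ⊆ (P n).carrier) → ∃ (ΦP : (n : ℕ) → ConformalEquiv (P n).carrier UpperHalfPlane.upperHalfPlaneSet) (LP : ℕ → ℂ → ℂ) (LbP : ℕ → ℂ) (LbarP : ℕ → ℂ → ℂ), (∀ n, ConformalFrame (P n) (ΦP n) (LP n) (LbP n) ∧ ContinuousOn (LbarP n) ((P n).carrier ∪ gateSeg (P n) (ρ / 2)) ∧ EqOn (LbarP n) (LP n) (P n).carrier) ∧ TendstoUniformlyOn (fun n x => Complex.exp ((5 / 8 : ℂ) * (LbarP n x - LbP n))) (fun x => Complex.exp ((5 / 8 : ℂ) * (Lbar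 x - Lb))) atTop (gateSeg D (ρ / 4))) → (∀ (Λ Λ' : Finset HexVertex), Λ ⊆ Λ' → ∀ (a z : Sym2 HexVertex) (x : ℝ), 0 ≤ x → ‖hexParafermionicObservable Λ a x 0 z‖ ≤ ‖hexParafermionicObservable Λ' a x 0 z‖) → (∀ (D : DobrushinDomain) (ρ : ℝ) (Λ : ℝ → Finset HexVertex) (m : ℝ → ℤ) (b : ℝ → Sym2 HexVertex), AdmissibleFamily D ρ Λ m b → ExactPolygonFamily D Λ → ∀ (a : ℝ → Sym2 HexVertex) (r₀ : ℝ) (m₀ : ℝ → ℤ), PinnedFlatRoot D Λ b (D.pt 0) a r₀ m₀ → 2 * ρ < dist (D.pt 0) (D.pt 1) → GateProfileAt D ρ (ρ / 2) Λ a b) → (∀ (D : DobrushinDomain) (ρ : ℝ) (Λ : ℝ → Finset HexVertex) (m : ℝ → ℤ) (b : ℝ → Sym2 HexVertex), AdmissibleFamily D ρ Λ m b → ∀ (a : ℝ → Sym2 HexVertex) (r₀ : ℝ) (m₀ : ℝ → ℤ), PinnedFlatRoot D Λ b (D.pt 0) a r₀ m₀ → CollarAvoidanceAt D ρ Λ a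 r₀) → ∀ (D : DobrushinDomain) (ρ : ℝ) (Λ : ℝ → Finset HexVertex) (m : ℝ → ℤ) (b : ℝ → Sym2 HexVertex), AdmissibleFamily D ρ Λ m b → ∀ (a : ℝ → Sym2 HexVertex) (r₀ : ℝ) (m₀ : ℝ → ℤ), PinnedFlatRoot D Λ b (D.pt 0) a r₀ m₀ → 2 * ρ < dist (D.pt 0) (D.pt 1) → GateProfileAt D ρ (ρ / 4) Λ a b :=
  fun hIP hGS hAM hPGP hGCA _ _ _ _ _ hAF _ _ _ hPR hdist =>
    gateProfile_of_innerPolygons hAM hPGP hGCA hIP hGS hAF hPR hdist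

end Summit.CriticalPhenomena.SAWScalingLimit.Theorems.PolygonParitySqueeze

end
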